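import Summits.BirchSwinnertonDyer.BirchSwinnertonDyer.Theorems.ClassRecordThreeCornerAtThreeShimuraWalkFamilyDictionary
import Summits.BirchSwinnertonDyer.BirchSwinnertonDyer.Theorems.ClassRecordThreeEulerHalvesAtThreeShimuraE0ReceptacleOfLabelB6
import Literature.NumberTheory.EllipticCurves.CMPointsIdentityComponentLabel
import HarnessLib

/-!
# From the port targets' binders `ShimuraWalk.LabelsAt` ∕ `ShimuraCMFamily.LabelB6` to the DATUM-FORM labels consumed by the family bricks —
# (B3), (B4), (B5) for any family of generalised Kolyvagin data with `(d m).y = ys m`, and the E⁰-receptacle over a split bad prime from (B6)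
# (cell `bsd-stepL`, seat `bsd-stepL-corner3-p2` g8 = WIDTH-LEVER lane B; `--supports stmt-BirchSwinnertonDyer-21420 --as helper`)

WHY (HOME/corner3/g8/CORNER3-G8.md §4 (γ)). The family bricks of this seat — Kummer places (p600152), sign (p600503), key relation (p601020),
stringent (p601311) — take the labels in DATUM form (`Σ_i (d m).σ_ℓ^i (d m).y = a_ℓ • (d (m∕ℓ)).y↑`, the congruence read through `(d m).toGeomPoints`,
`τm (d m).y − ε σ′ (d m).y` torsion) and the receptacle in the output shape of g5's `receptacle_of_labelB6`. The port targets
`ShimuraWalk.{Swap,Level}SupplyAtThreeB6` hand the prover `LabelsAt W N K ι y ys ε` and `LabelB6 ι W N (N.primeFactors.filter (· ∉ S)) ys`. THIS FILE is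
the one-screen conversion, for ANY family `d : (m ∣ n) → KolyvaginFamilyData W K ι m` with `(d m hm).y = ys m` (e.g. `exists_coherent_familyData_y_eq`):
* `familyLabels_of_labelsAt` — (B4), (B5), (B3) in datum form (instantiate (B4) at the datum's generator `(d m).σ_ℓ` (`zpowers_σ`), (B5) at the datum's
  embedding `(d m).emb` with `j := (d m).toGeomPoints = E((d m).emb)` (`rfl`), (B3) verbatim);
* `familyReceptacle_of_labelB6` — for `q ∈ Q` prime, `q ∣ N`, split in `K`: `IsCoprime p #E(ℚ)_tors` and the receptacle
  `#E(ℚ)_tors • ((d m).toGeomPoints (γ • y(m)))_v ∈ E⁰(K̄_v)` (and for `y(m∕ℓ)↑`) at every `v ∋ q` — g5's `receptacle_of_labelB6` fed with `LabelB6.at'`.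
HONEST FRAMING: theorems only (no definition, no named fact, no `sorry`); unfolding ∕ instantiation of labels; nothing about any curve is asserted (the
labels are hypotheses); no stub closes; BSD is not proved by any of this; T7. Credit: defn-ty1 g16 ((B6) typed), tam3-p1 g12 ∕ this seat g5 (receptacle).
References: [cite: GrossLMS1991, §3 Prop. 3.7 (1)(2), §5 Prop. 5.3, §6 Prop. 6.2 (1)] [cite: Nekovar2007, (4.8), (4.9)] [cite: Zhang2001Heights, §4.4].
presearch: not applicable (unfolding of tree predicates); `lean search 'familyLabels_of_labelsAt|familyReceptacle_of_labelB6'` → none.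
-/

set_option autoImplicit false
set_option linter.dupNamespace false

noncomputable section

open scoped Classical

namespace Summit.BirchSwinnertonDyer.BirchSwinnertonDyer.Theorems.ShimuraWalk

open WeierstrassCurve Field NumberField IsDedekindDomain Finset
  Literature.NumberTheory.EllipticCurves Literature.NumberTheory.GaloisRepresentations
  Literature.NumberTheory.EllipticCurves.RingClassField
  Literature.NumberTheory.EllipticCurves.ShimuraCMFamily
  Summit.BirchSwinnertonDyer.Rank1Residual.X11b
  Summit.BirchSwinnertonDyer.Rank1Residual.JET
  Summit.BirchSwinnertonDyer.BirchSwinnertonDyer.Theorems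

variable {K : Type} [Field K] [NumberField K] {W : WeierstrassCurve ℚ} {ι : K →+* ℂ}

/-- **(B4), (B5), (B3) in datum form from `LabelsAt`** for a family of data with `(d m).y = ys m` at the divisors of a square-free `n` whose prime
factors satisfy the level guard. [cite: GrossLMS1991, Prop. 3.7 (1)(2), Prop. 5.3] [cite: Nekovar2007, (4.8), (4.9)] -/
theorem familyLabels_of_labelsAt {N : ℕ} [W.IsElliptic] [W.IsGloballyMinimal]
    {n : ℕ} (hn : Squarefree n) (hguard : ∀ q ∈ n.primeFactors, ¬ q ∣ N ∧ (Ideal.span {(q : 𝓞 K)}).IsPrime)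
    (ys : (m : ℕ) → (W.baseChange (ringClassField K ι m)).toAffine.Point)
    {yK : (W.baseChange K).toAffine.Point} {ε : ℤ} (hL : LabelsAt W N K ι yK ys ε)
    (d : (m : ℕ) → m ∣ n → KolyvaginFamilyData W K ι m) (hy : ∀ (m : ℕ) (hm : m ∣ n), (d m hm).y = ys m) :
    (∀ (m : ℕ) (hm : m ∣ n), ∀ (ℓ : ℕ) (hℓ : ℓ ∈ m.primeFactors)
      (hle : ringClassField K ι (m / ℓ) ≤ ringClassField K ι m),
      letI : Algebra K ℂ := ι.toAlgebra
      ∑ i ∈ Finset.range (ℓ + 1), pointGalHom W (ringClassField K ι m) ((d m hm).σ ℓ ^ i) (d m hm).y =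
        W.frobeniusTrace ℓ • WeierstrassCurve.Affine.Point.map (W' := W)
          ((RingClassField.inclusion ι hle).restrictScalars ℚ)
          (d (m / ℓ) ((Nat.div_dvd_of_dvd (Nat.dvd_of_mem_primeFactors hℓ)).trans hm)).y) ∧
    (∀ (m : ℕ) (hm : m ∣ n) (ℓ : ℕ) (hℓ : ℓ ∈ m.primeFactors) [Fact ℓ.Prime]
      (hΔ : ¬ (ℓ : ℤ) ∣ minimalDiscriminantInt W) (φ₀ : absoluteGaloisGroup (ZMod ℓ)),
      (∀ x : AlgebraicClosure (ZMod ℓ), φ₀ • x = x ^ ℓ) →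
      ∀ (hle : ringClassField K ι (m / ℓ) ≤ ringClassField K ι m)
        (γ : ringClassField K ι m ≃ₐ[ℚ] ringClassField K ι m), γ ∈ ringClassGal ι m →
        letI : Algebra K ℂ := ι.toAlgebra
        geomReduction hΔ ((RatClosure.pointsEquiv (K := K) W).symm
            ((d m hm).toGeomPoints (pointGalHom W (ringClassField K ι m) γ (d m hm).y))) =
          φ₀ • geomReduction hΔ ((RatClosure.pointsEquiv (K := K) W).symm
            ((d m hm).toGeomPoints (pointGalHom W (ringClassField K ι m) γ
              (WeierstrassCurve.Affine.Point.map (W' := W)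
                ((RingClassField.inclusion ι hle).restrictScalars ℚ)
                (d (m / ℓ) ((Nat.div_dvd_of_dvd (Nat.dvd_of_mem_primeFactors hℓ)).trans hm)).y))))) ∧
    (∀ (m : ℕ) (hm : m ∣ n) (τm : ringClassField K ι m ≃ₐ[ℚ] ringClassField K ι m),
      (∀ x : ringClassField K ι m, ((τm x : ringClassField K ι m) : ℂ) = starRingEnd ℂ x) →
      ∃ σ' ∈ ringClassGal ι m, IsOfFinAddOrder
        (pointGalHom W (ringClassField K ι m) τm (d m hm).y -
          ε • pointGalHom W (ringClassField K ι m) σ' (d m hm).y)) := by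
  obtain ⟨-, -, hB3, -, hB4, hB5⟩ := hL
  have hn0 : n ≠ 0 := hn.ne_zero
  have hg : ∀ (m : ℕ), m ∣ n → ∀ q ∈ m.primeFactors, ¬ q ∣ N ∧ (Ideal.span {(q : 𝓞 K)}).IsPrime :=
    fun m hm q hq ↦ hguard q (Nat.primeFactors_mono hm hn0 hq)
  refine ⟨fun m hm ℓ hℓ hle ↦ ?_, fun m hm ℓ hℓ _ hΔ φ₀ hφ₀ hle γ hγ ↦ ?_, fun m hm τm hτm ↦ ?_⟩
  · have h := hB4 m (hn.squarefree_of_dvd hm) (hg m hm) ℓ hℓ hle ((d m hm).σ ℓ) ((d m hm).zpowers_σ ℓ hℓ)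
    rw [hy m hm, hy (m / ℓ)]
    exact h
  · have h := hB5 m (hn.squarefree_of_dvd hm) (hg m hm) ℓ hℓ hΔ φ₀ hφ₀ hle (d m hm).emb (d m hm).emb_apply
      (d m hm).toGeomPoints rfl γ hγ
    rw [hy m hm, hy (m / ℓ)]
    exact h
  · rw [hy m hm]
    exact hB3 m (ne_zero_of_dvd_ne_zero hn0 hm) τm hτm

/-- **The E⁰-receptacle over a split bad prime from (B6), in the shape the family bricks consume**: for `q ∈ Q` prime with `q ∣ N` and two primes
of `K` above it, `p` prime to `#E(ℚ)_tors` (irreducible `E[p]`), and at every `m ∣ n`, every `γ`, every `v ∋ q`: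
`#E(ℚ)_tors • ((d m).toGeomPoints (γ • y(m)))_v ∈ E⁰(K̄_v)` and the same for the `y(m∕ℓ)↑` (g5's `receptacle_of_labelB6` on `LabelB6.at'`).
[cite: GrossLMS1991, §6 proof of Prop. 6.2 (1)] [cite: Zhang2001Heights, §4.4] -/
theorem familyReceptacle_of_labelB6 {N : ℕ} [W.IsElliptic] [W.IsGloballyMinimal] (hK : IsImaginaryQuadratic K) (ι : K →+* ℂ)
    (p : ℕ) [Fact p.Prime] (hirr : W.HasIrreducibleModPGaloisRep p)
    [∀ j : ℕ, NumberField (ringClassField K ι j)]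
    {n : ℕ} (hn : Squarefree n) (hguard : ∀ q ∈ n.primeFactors, ¬ q ∣ N ∧ (Ideal.span {(q : 𝓞 K)}).IsPrime)
    (ys : (m : ℕ) → (W.baseChange (ringClassField K ι m)).toAffine.Point)
    {Q : Finset ℕ} (hB6 : LabelB6 ι W N Q ys)
    (d : (m : ℕ) → m ∣ n → KolyvaginFamilyData W K ι m) (hy : ∀ (m : ℕ) (hm : m ∣ n), (d m hm).y = ys m) :
    IsCoprime (p : ℤ) (W.torsionOrder : ℤ) ∧
    ∀ (q : ℕ), q ∈ Q → q.Prime → q ∣ N → ((Ideal.span {(q : ℤ)}).primesOver (𝓞 K)).ncard = 2 →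
      ∀ (m : ℕ) (hm : m ∣ n) (γ : ringClassField K ι m ≃ₐ[ℚ] ringClassField K ι m) (v : HeightOneSpectrum (𝓞 K)),
      ((q : ℕ) : 𝓞 K) ∈ v.asIdeal →
        (W.torsionOrder : ℤ) • pointsMap (W.baseChange K) (v.adicCompletion K)
            ((d m hm).toGeomPoints (pointGalHom W (ringClassField K ι m) γ (d m hm).y)) ∈
          E0Receptacle (W.baseChange K) v ∧
        ∀ (ℓ : ℕ) (hℓ : ℓ ∈ m.primeFactors)
          (hle : ringClassField K ι (m / ℓ) ≤ ringClassField K ι m),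
          (W.torsionOrder : ℤ) • pointsMap (W.baseChange K) (v.adicCompletion K)
              ((d m hm).toGeomPoints (pointGalHom W (ringClassField K ι m) γ
                (WeierstrassCurve.Affine.Point.map (W' := W)
                  ((RingClassField.inclusion ι hle).restrictScalars ℚ)
                  (d (m / ℓ) ((Nat.div_dvd_of_dvd (Nat.dvd_of_mem_primeFactors hℓ)).trans hm)).y))) ∈
            E0Receptacle (W.baseChange K) v := by
  have hn0 : n ≠ 0 := hn.ne_zero
  have hg : ∀ (m : ℕ), m ∣ n → ∀ q ∈ m.primeFactors, ¬ q ∣ N ∧ (Ideal.span {(q : 𝓞 K)}).IsPrime :=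
    fun m hm q hq ↦ hguard q (Nat.primeFactors_mono hm hn0 hq)
  refine ⟨ShimuraKolyvaginOfImage.isCoprime_torsionOrder_of_irr W p hirr, ?_⟩
  intro q hqQ hqp hqN hq2 m hm γ v hqv
  haveI : Fact q.Prime := ⟨hqp⟩
  obtain ⟨-, hrec⟩ := ShimuraKolyvaginOfImage.receptacle_of_labelB6 W hK ι p hirr q hqN hq2 ys (hB6.at' hqQ)
  obtain ⟨h1, h2⟩ := hrec m (hn.squarefree_of_dvd hm) (hg m hm) (d m hm).emb.toRatAlgHom γ v hqv
  refine ⟨?_, fun ℓ hℓ hle ↦ ?_⟩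
  · rw [hy m hm]
    exact h1
  · have hm' : m / ℓ ∣ n := (Nat.div_dvd_of_dvd (Nat.dvd_of_mem_primeFactors hℓ)).trans hm
    rw [hy (m / ℓ) hm']
    exact h2 (m / ℓ) (hn.squarefree_of_dvd hm') (hg (m / ℓ) hm') hle

end Summit.BirchSwinnertonDyer.BirchSwinnertonDyer.Theorems.ShimuraWalk

end
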